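import Mathlib
import HarnessLib
import HarnessLib.Audit

/-!
# Marica–Schönheim for cube edges (and the fiber trick) — hp-7 gen 65

Support file for crux `stmt-CriticalPhenomena-4575` (route `PercNearOneGluingNoHeavy`), hull-port seat `prim-hp-7` (generation 65);
`--supports stmt-CriticalPhenomena-4575`.  No `sorry`, theorems only.  Memo: `run/shared/lean/prim/prim-hp-7/FROM-prim-hp-7-g65-REDUCTIONS.md` §5(★1).

For a set family `𝒜` and a coordinate `r`, the `r`-TWINS of `𝒜` are the members `e` with `r ∉ e` and `insert r e ∈ 𝒜` — the lower ends of the edges of `𝒜`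
in direction `r` of the hypercube graph.  **Theorem** (`card_twins_le_card_twins_diffs`): the difference family `𝒜 \\ 𝒜` has at least as many `r`-edges as `𝒜`.
Proof ("fiber trick"): if `q, q'` are twins of `𝒜` then `q \ q' = q \ insert r q'` and `insert r (q \ q') = insert r q \ q'` are both differences, so
`(twins of 𝒜) \\ (twins of 𝒜) ⊆ twins of (𝒜 \\ 𝒜)`, and Marica–Schönheim (`Finset.card_le_card_diffs`) bounds the left side from below by the number of twins.
This is the one-axis, difference-family analogue of the edge lemma Δ-R_n to which generation 65 reduced Conjecture HEX-MS (companion file `…HexMSDelta`).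
-/

namespace Summit.CriticalPhenomena.PercolationContinuityZ3.Theorems

namespace GeneratedDonors

open Finset FinsetFamily

variable {α : Type*} [DecidableEq α]

/-- The lower ends of the `r`-edges of a family: members `e ∌ r` with `insert r e` also a member. -/
theorem mem_filter_twin {𝒜 : Finset (Finset α)} {r : α} {e : Finset α} :
    e ∈ 𝒜.filter (fun e => r ∉ e ∧ insert r e ∈ 𝒜) ↔ e ∈ 𝒜 ∧ r ∉ e ∧ insert r e ∈ 𝒜 := by
  rw [mem_filter]

/-- **Fiber trick**: differences of `r`-twins of `𝒜` are `r`-twins of the difference family `𝒜 \\ 𝒜`. -/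
theorem diffs_twins_subset_twins_diffs (𝒜 : Finset (Finset α)) (r : α) :
    (𝒜.filter fun e => r ∉ e ∧ insert r e ∈ 𝒜) \\ (𝒜.filter fun e => r ∉ e ∧ insert r e ∈ 𝒜)
      ⊆ (𝒜 \\ 𝒜).filter fun q => r ∉ q ∧ insert r q ∈ 𝒜 \\ 𝒜 := by
  intro d hd
  rw [mem_diffs] at hd
  obtain ⟨q, hq, q', hq', rfl⟩ := hd
  rw [mem_filter] at hq hq'
  obtain ⟨hqA, hrq, hqins⟩ := hq
  obtain ⟨hq'A, hrq', hq'ins⟩ := hq'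
  rw [mem_filter]
  refine ⟨mem_diffs.mpr ⟨q, hqA, q', hq'A, rfl⟩, fun h => hrq (mem_sdiff.mp h).1, ?_⟩
  -- insert r (q \ q') = (insert r q) \ q'
  have : insert r (q \ q') = insert r q \ q' := by
    ext i
    simp only [mem_insert, mem_sdiff]
    constructor
    · rintro (rfl | ⟨hiq, hiq'⟩)
      · exact ⟨Or.inl rfl, hrq'⟩
      · exact ⟨Or.inr hiq, hiq'⟩
    · rintro ⟨(rfl | hiq), hiq'⟩
      · exact Or.inl rfl
      · exact Or.inr ⟨hiq, hiq'⟩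
  rw [this]
  exact mem_diffs.mpr ⟨insert r q, hqins, q', hq'A, rfl⟩

/-- **Marica–Schönheim for cube edges**: in every direction `r`, the difference family `𝒜 \\ 𝒜` has at least as many edges as `𝒜`
(for `r` outside every member this is vacuous; summing over `r` bounds the edge count of `𝒜 \\ 𝒜` in the hypercube graph by that of `𝒜`). -/
theorem card_twins_le_card_twins_diffs (𝒜 : Finset (Finset α)) (r : α) :
    #(𝒜.filter fun e => r ∉ e ∧ insert r e ∈ 𝒜) ≤ #((𝒜 \\ 𝒜).filter fun q => r ∉ q ∧ insert r q ∈ 𝒜 \\ 𝒜) :=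
  (card_le_card_diffs _).trans (card_le_card (diffs_twins_subset_twins_diffs 𝒜 r))

end GeneratedDonors

end Summit.CriticalPhenomena.PercolationContinuityZ3.Theorems
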